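import Summits.CriticalPhenomena.PercolationContinuityZ3.Theorems.PercNearOneGluingNoHeavyLowerTailSunflowerSafeCalculus
import Literature.Probability.Percolation.LongRangeKernelPercolationProofs
import HarnessLib

/-!
# `NoHeavyLowerTail` (crux stmt-CriticalPhenomena-4575), abstract sunflower cubic: SAFETY IS A CLOSED CONDITION IN THE PARAMETERS —
# it suffices to prove it at interior parameter points

Support file (seat `prim-ineq-prove-1` gen 67; `--supports stmt-CriticalPhenomena-4575`).  No `sorry`, no named facts, no new definitions.
Memo: run/shared/lean/prim/prim-ineq-prove-1/FINDING-FREEFOUR-prove1-g67.md §1 (the "routine closure" between the analytic `FreeFour` —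
which wants positive floors, i.e. interior coins — and `LeafLeafSafe`, which quantifies over all parameter vectors).

`Safe p A` (`…SunflowerSafeCalculus`) compares, for each finite family, a product of probabilities `∏ μ_p(V_i)` with a power `μ_p(A)^(n−1)`;
both are continuous in `p` on the compact cube `ι → unitInterval` (`continuous_prodBernoulli_real_of_determinedBy`, every event on a
finite `ι` being determined by all coordinates), so the set of `p` at which the comparison holds is closed, and the interior points
`0 < p_i < 1` are dense (explicit sequence `p_i(1−2δ_m) + δ_m`, `δ_m = 1/(3(m+1))`).
* **`safe_of_forall_interior`** — if `A` is safe at every `p` with `0 < p_i < 1` for all `i`, then `A` is safe at every `p`.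
-/

noncomputable section

namespace Summit.CriticalPhenomena.PercolationContinuityZ3.Theorems.SunflowerPartition

namespace SafeCalc

open MeasureTheory Finset Filter Topology
open Literature.Probability.LatticeModels Literature.Probability.Percolation

variable {ι : Type*} [Fintype ι]

/-- `p ↦ μ_p(B)` is continuous on the parameter cube, for every event `B` on a finite index set (every event is determined by all
coordinates, cf. `LomonosovPolesskii1972.determinedBy_univ`; `continuous_prodBernoulli_real_of_determinedBy`). [this work] -/
theorem continuous_real_prodBernoulli (B : Set (Set ι)) :
    Continuous fun q : ι → unitInterval => (prodBernoulli q).real B :=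
  continuous_prodBernoulli_real_of_determinedBy (fun q : ι → unitInterval => q) (F := Finset.univ)
    (by rw [determinedBy_iff]; intro ω ω' h; rw [Finset.coe_univ, Set.inter_univ, Set.inter_univ] at h; rw [h])
    fun i _ => continuous_subtype_val.comp (continuous_apply i)

/-- **Safety at all interior parameter points implies safety everywhere** (`Safe` is a closed condition in `p`). [this work] -/
theorem safe_of_forall_interior {A : Set (Set ι)}
    (h : ∀ p : ι → unitInterval, (∀ i, 0 < (p i : ℝ) ∧ (p i : ℝ) < 1) → Safe p A) (p : ι → unitInterval) : Safe p A := by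
  classical
  intro n V hV hcap
  -- an interior sequence converging to `p`
  set δ : ℕ → ℝ := fun m => (1 : ℝ) / 3 * (1 / ((m : ℝ) + 1)) with hδ
  have hδ0 : ∀ m, 0 < δ m := fun m => by simp only [hδ]; positivity
  have hδ1 : ∀ m, δ m ≤ 1 / 3 := fun m => by
    simp only [hδ]
    have h1 : 1 / ((m : ℝ) + 1) ≤ 1 := by
      rw [div_le_one (by positivity)]; linarith [(Nat.cast_nonneg m : (0 : ℝ) ≤ m)]
    nlinarith
  have hδt : Tendsto δ atTop (𝓝 0) := by
    have h1 : Tendsto (fun m : ℕ => 1 / ((m : ℝ) + 1)) atTop (𝓝 (0 : ℝ)) := tendsto_one_div_add_atTop_nhds_zero_nat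
    have h2 := h1.const_mul ((1 : ℝ) / 3)
    rw [mul_zero] at h2
    exact h2
  have hmem : ∀ m i, (p i : ℝ) * (1 - 2 * δ m) + δ m ∈ unitInterval := by
    intro m i
    have h0 : 0 ≤ (p i : ℝ) := (p i).2.1
    have h1 : (p i : ℝ) ≤ 1 := (p i).2.2
    have h2 : 0 ≤ 1 - 2 * δ m := by linarith [hδ1 m]
    constructor
    · nlinarith [hδ0 m]
    · nlinarith [hδ0 m, mul_le_mul_of_nonneg_right h1 h2]
  set q : ℕ → ι → unitInterval := fun m i => ⟨(p i : ℝ) * (1 - 2 * δ m) + δ m, hmem m i⟩ with hq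
  have hqint : ∀ m i, 0 < (q m i : ℝ) ∧ (q m i : ℝ) < 1 := by
    intro m i
    have h0 : 0 ≤ (p i : ℝ) := (p i).2.1
    have h1 : (p i : ℝ) ≤ 1 := (p i).2.2
    have h2 : 0 ≤ 1 - 2 * δ m := by linarith [hδ1 m]
    simp only [hq]
    constructor
    · nlinarith [hδ0 m]
    · nlinarith [hδ0 m, mul_le_mul_of_nonneg_right h1 h2]
  have hqt : Tendsto q atTop (𝓝 p) := by
    rw [tendsto_pi_nhds]
    intro i
    rw [tendsto_subtype_rng]
    have h1 : Tendsto (fun m => (p i : ℝ) * (1 - 2 * δ m) + δ m) atTop (𝓝 ((p i : ℝ) * (1 - 2 * 0) + 0)) :=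
      ((hδt.const_mul 2).const_sub 1 |>.const_mul _).add hδt
    simpa using h1
  -- both sides of the safety inequality are continuous in `p`
  have hf : Continuous fun r : ι → unitInterval => ∏ i, (prodBernoulli r).real (V i) :=
    continuous_finsetProd _ fun i _ => continuous_real_prodBernoulli (V i)
  have hg : Continuous fun r : ι → unitInterval => ((prodBernoulli r).real A) ^ (n - 1) :=
    (continuous_real_prodBernoulli A).pow _
  have hle : ∀ m, (fun r : ι → unitInterval => ∏ i, (prodBernoulli r).real (V i)) (q m) ≤
      (fun r : ι → unitInterval => ((prodBernoulli r).real A) ^ (n - 1)) (q m) :=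
    fun m => h (q m) (hqint m) n V hV hcap
  exact le_of_tendsto_of_tendsto' (hf.continuousAt.tendsto.comp hqt) (hg.continuousAt.tendsto.comp hqt) hle

end SafeCalc

end Summit.CriticalPhenomena.PercolationContinuityZ3.Theorems.SunflowerPartition
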